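import Summits.Ventures.PercRepro.SevenThreeNullity

/-!
# PercRepro — the `(7,3)` cell: the cyclic part of a witness and the direct-sum formula for `D` (p3, gen 15)

For a finset `S ⊆ E` the COLOOPS of the restriction `M|S` are the points `y ∈ S` outside `cl(S ∖ y)` (`coloopsOf`), and the
CYCLIC PART is `K(S) = S ∖ coloops(S)` (`cyclicPart`) — the union of the circuits of `M|S`. This file proves, primally:
* `eRk_cyclicPart_add`: `ρ(K(S)) + #coloops(S) = ρ(S)` (each coloop drops the rank by one; coloops persist under deletion);
* `mem_closure_erase_of_mem_cyclicPart`: `K(S)` has no coloop of its own — every `k ∈ K(S)` lies in `cl(K(S) ∖ k)`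
  (the exchange argument: a point of `K(S)` spanned only with the help of a coloop `y` would put `y` in `cl(S ∖ y)`);
* `D_eq_sum_cyclicPart`: `D(S) = Σ_{j ≤ 3} C(#coloops(S), j)·Φ_{3−j}(K(S))` (the coloop direct sum of `SevenThreePhi.lean`).
So the denominator of any witness is determined by its cyclic part and its number of coloops; for a witness of nullity
`n(S) = |S| − ρ(S)`, the cyclic part has the same nullity (`eRk_cyclicPart_add` with `card_cyclicPart_add`) and no coloops — the input of Lemma 27.2
(nullity `2`: the series classes; M4 of `P3-C025-seven-three-plan.md`) and of the grouping by the cyclic part (M5).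
-/

namespace PercRepro

namespace SevenThree

open Finset ThmH SixThree

variable {α : Type*} [DecidableEq α] {M : Matroid α} [M.Finite]

open scoped Classical in
/-- The coloops of the restriction `M|S`: the points of `S` outside the closure of the rest of `S`. -/
noncomputable def coloopsOf (M : Matroid α) [M.Finite] (S : Finset α) : Finset α :=
  S.filter (fun y => y ∉ M.closure ((S.erase y : Finset α) : Set α))

/-- The cyclic part `K(S) = S ∖ coloops(S)`. -/
noncomputable def cyclicPart (M : Matroid α) [M.Finite] (S : Finset α) : Finset α := S \ coloopsOf M S

open scoped Classical in
/-- Membership in `coloopsOf`. -/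
theorem mem_coloopsOf {S : Finset α} {y : α} :
    y ∈ coloopsOf M S ↔ y ∈ S ∧ y ∉ M.closure ((S.erase y : Finset α) : Set α) := by
  unfold coloopsOf
  simp only [Finset.mem_filter]

open scoped Classical in
/-- `coloopsOf M S ⊆ S`. -/
theorem coloopsOf_subset (M : Matroid α) [M.Finite] (S : Finset α) : coloopsOf M S ⊆ S := by
  unfold coloopsOf
  exact Finset.filter_subset _ _

/-- `cyclicPart M S ⊆ S`. -/
theorem cyclicPart_subset (M : Matroid α) [M.Finite] (S : Finset α) : cyclicPart M S ⊆ S :=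
  Finset.sdiff_subset

/-- Membership in `cyclicPart`. -/
theorem mem_cyclicPart {S : Finset α} {k : α} :
    k ∈ cyclicPart M S ↔ k ∈ S ∧ k ∈ M.closure ((S.erase k : Finset α) : Set α) := by
  unfold cyclicPart
  rw [Finset.mem_sdiff, mem_coloopsOf]
  constructor
  · rintro ⟨hk, h⟩
    refine ⟨hk, ?_⟩
    by_contra hcl
    exact h ⟨hk, hcl⟩
  · rintro ⟨hk, hcl⟩
    exact ⟨hk, fun h => h.2 hcl⟩

/-- The cyclic part and the coloops partition `S`. -/
theorem cyclicPart_union_coloopsOf (S : Finset α) : cyclicPart M S ∪ coloopsOf M S = S := by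
  unfold cyclicPart
  exact Finset.sdiff_union_of_subset (coloopsOf_subset M S)

/-- The cyclic part and the coloops are disjoint. -/
theorem disjoint_cyclicPart_coloopsOf (S : Finset α) : Disjoint (cyclicPart M S) (coloopsOf M S) := by
  unfold cyclicPart
  exact Finset.sdiff_disjoint

/-- Removing a coloop drops the rank by exactly one. -/
theorem eRk_erase_add_one_of_mem_coloopsOf {S : Finset α} (hS : S ⊆ gr M) {y : α} (hy : y ∈ coloopsOf M S) :
    M.eRk ((S.erase y : Finset α) : Set α) + 1 = M.eRk (S : Set α) := by
  rw [mem_coloopsOf] at hy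
  have h := eRk_insert_eq_succ_of_notMem_closure (hS hy.1) hy.2
  rw [Finset.insert_erase hy.1] at h
  exact h.symm

/-- A coloop of `S` other than `y` is a coloop of `S ∖ y`. -/
theorem mem_coloopsOf_erase {S : Finset α} {y z : α} (hz : z ∈ coloopsOf M S) (hzy : z ≠ y) :
    z ∈ coloopsOf M (S.erase y) := by
  rw [mem_coloopsOf] at hz ⊢
  refine ⟨Finset.mem_erase.2 ⟨hzy, hz.1⟩, fun h => hz.2 ?_⟩
  apply M.closure_subset_closure _ h
  rw [Finset.coe_subset]
  intro e he
  rw [Finset.mem_erase] at he ⊢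
  exact ⟨he.1, Finset.mem_of_mem_erase he.2⟩

/-- Conversely, a point of `S ∖ y` outside the closure of `(S ∖ y) ∖ z`, when `y` is a coloop of `S`, is a coloop of `S`
(the rank of `S ∖ z` exceeds that of `(S ∖ y) ∖ z` by one: `y` stays a coloop of `S ∖ z`). -/
theorem mem_coloopsOf_of_erase {S : Finset α} (hS : S ⊆ gr M) {y z : α} (hy : y ∈ coloopsOf M S) (hzy : z ≠ y)
    (hz : z ∈ coloopsOf M (S.erase y)) : z ∈ coloopsOf M S := by
  rw [mem_coloopsOf] at hz hy ⊢
  refine ⟨Finset.mem_of_mem_erase hz.1, ?_⟩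
  intro hzcl
  apply hz.2
  -- `(S ∖ y) ∖ z = (S ∖ z) ∖ y`; `y ∉ cl(S ∖ y) ⊇ cl((S ∖ z) ∖ y)` so `z ∈ cl((S ∖ z)) = cl(insert y ((S ∖ z) ∖ y))`
  -- forces `z ∈ cl((S ∖ z) ∖ y)` by exchange (else `y ∈ cl(insert z ((S ∖ z) ∖ y)) = cl(S ∖ y)`).
  have hcomm : (S.erase y).erase z = (S.erase z).erase y := Finset.erase_right_comm
  rw [hcomm]
  have hyE : y ∈ M.E := by rw [← coe_gr M]; exact_mod_cast hS hy.1
  have hzS : z ∈ S := Finset.mem_of_mem_erase hz.1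
  have hins : insert y ((S.erase z).erase y) = S.erase z := by
    apply Finset.insert_erase
    exact Finset.mem_erase.2 ⟨fun h => hzy h.symm, hy.1⟩
  by_contra hzcl'
  have hz' : z ∈ M.closure ((insert y ((S.erase z).erase y) : Finset α) : Set α) := by
    rw [hins]; exact hzcl
  rw [Finset.coe_insert] at hz'
  have hexch := Matroid.mem_closure_insert hzcl' hz'
  apply hy.2
  have hins' : insert z ((S.erase z).erase y) = S.erase y := by
    rw [← hcomm]
    exact Finset.insert_erase hz.1
  rw [← hins', Finset.coe_insert]
  exact hexch

/-- The coloops of `S ∖ y` for a coloop `y` of `S` are exactly the other coloops of `S`. -/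
theorem coloopsOf_erase_eq {S : Finset α} (hS : S ⊆ gr M) {y : α} (hy : y ∈ coloopsOf M S) :
    coloopsOf M (S.erase y) = (coloopsOf M S).erase y := by
  ext z
  rw [Finset.mem_erase]
  constructor
  · intro hz
    have hzy : z ≠ y := by
      intro h
      rw [mem_coloopsOf, h] at hz
      exact (Finset.notMem_erase y S) hz.1
    exact ⟨hzy, mem_coloopsOf_of_erase hS hy hzy hz⟩
  · rintro ⟨hzy, hz⟩
    exact mem_coloopsOf_erase hz hzy

/-- **The rank of the cyclic part**: `ρ(K(S)) + #coloops(S) = ρ(S)`. -/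
theorem eRk_cyclicPart_add {S : Finset α} (hS : S ⊆ gr M) :
    M.eRk ((cyclicPart M S : Finset α) : Set α) + ((coloopsOf M S).card : ℕ∞) = M.eRk (S : Set α) := by
  classical
  -- strong induction on the number of coloops
  suffices H : ∀ n : ℕ, ∀ S : Finset α, S ⊆ gr M → (coloopsOf M S).card = n →
      M.eRk ((cyclicPart M S : Finset α) : Set α) + (n : ℕ∞) = M.eRk (S : Set α) from
    H _ S hS rfl
  intro n
  induction n with
  | zero =>
    intro S _ h0
    have hc : coloopsOf M S = ∅ := Finset.card_eq_zero.1 h0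
    unfold cyclicPart
    rw [hc, Finset.sdiff_empty]
    simp
  | succ n ih =>
    intro S hS hcard
    obtain ⟨y, hy⟩ : (coloopsOf M S).Nonempty := Finset.card_pos.1 (by omega)
    have hS' : S.erase y ⊆ gr M := (Finset.erase_subset _ _).trans hS
    have hcard' : (coloopsOf M (S.erase y)).card = n := by
      rw [coloopsOf_erase_eq hS hy, Finset.card_erase_of_mem hy, hcard]
      rfl
    have hcyc : cyclicPart M (S.erase y) = cyclicPart M S := by
      unfold cyclicPart
      rw [coloopsOf_erase_eq hS hy]
      ext e
      simp only [Finset.mem_sdiff, Finset.mem_erase]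
      constructor
      · rintro ⟨⟨hey, heS⟩, h⟩
        exact ⟨heS, fun hc => h ⟨hey, hc⟩⟩
      · rintro ⟨heS, h⟩
        have hey : e ≠ y := fun hh => h (hh ▸ hy)
        exact ⟨⟨hey, heS⟩, fun hc => h hc.2⟩
    have h1 := ih (S.erase y) hS' hcard'
    rw [hcyc] at h1
    rw [← eRk_erase_add_one_of_mem_coloopsOf hS hy, ← h1]
    push_cast
    ring

/-- **The cyclic part has no coloops**: every `k ∈ K(S)` lies in `cl(K(S) ∖ k)`. -/
theorem mem_closure_erase_of_mem_cyclicPart {S : Finset α} (hS : S ⊆ gr M) {k : α} (hk : k ∈ cyclicPart M S) :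
    k ∈ M.closure (((cyclicPart M S).erase k : Finset α) : Set α) := by
  classical
  -- induction on the coloops: `k ∈ cl(S ∖ k)`; removing the coloops one at a time keeps `k` in the closure by exchange
  suffices H : ∀ n : ℕ, ∀ S : Finset α, S ⊆ gr M → (coloopsOf M S).card = n → ∀ k ∈ cyclicPart M S,
      k ∈ M.closure (((cyclicPart M S).erase k : Finset α) : Set α) from
    H _ S hS rfl k hk
  intro n
  induction n with
  | zero =>
    intro S _ h0 k hk
    have hc : coloopsOf M S = ∅ := Finset.card_eq_zero.1 h0
    have hcyc : cyclicPart M S = S := by unfold cyclicPart; rw [hc, Finset.sdiff_empty]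
    rw [hcyc]
    rw [hcyc] at hk
    by_contra hcl
    have : k ∈ coloopsOf M S := mem_coloopsOf.2 ⟨hk, hcl⟩
    rw [hc] at this
    exact Finset.notMem_empty _ this
  | succ n ih =>
    intro S hS hcard k hk
    obtain ⟨y, hy⟩ : (coloopsOf M S).Nonempty := Finset.card_pos.1 (by omega)
    have hS' : S.erase y ⊆ gr M := (Finset.erase_subset _ _).trans hS
    have hcard' : (coloopsOf M (S.erase y)).card = n := by
      rw [coloopsOf_erase_eq hS hy, Finset.card_erase_of_mem hy, hcard]
      rfl
    have hcyc : cyclicPart M (S.erase y) = cyclicPart M S := by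
      unfold cyclicPart
      rw [coloopsOf_erase_eq hS hy]
      ext e
      simp only [Finset.mem_sdiff, Finset.mem_erase]
      constructor
      · rintro ⟨⟨hey, heS⟩, h⟩
        exact ⟨heS, fun hc => h ⟨hey, hc⟩⟩
      · rintro ⟨heS, h⟩
        have hey : e ≠ y := fun hh => h (hh ▸ hy)
        exact ⟨⟨hey, heS⟩, fun hc => h hc.2⟩
    have := ih (S.erase y) hS' hcard' k (by rw [hcyc]; exact hk)
    rw [hcyc] at this
    exact this

/-- The coloops of `S` lie outside the closure of `K(S)` together with the other coloops. -/
theorem coloops_notMem_closure {S : Finset α} {y : α} (hy : y ∈ coloopsOf M S) :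
    y ∉ M.closure ((cyclicPart M S ∪ (coloopsOf M S).erase y : Finset α) : Set α) := by
  have heq : cyclicPart M S ∪ (coloopsOf M S).erase y = S.erase y := by
    have h1 : y ∉ cyclicPart M S := fun h => (Finset.mem_sdiff.1 h).2 hy
    ext e
    simp only [Finset.mem_union, Finset.mem_erase]
    constructor
    · rintro (he | ⟨hey, he⟩)
      · exact ⟨fun hh => h1 (hh ▸ he), cyclicPart_subset M S he⟩
      · exact ⟨hey, coloopsOf_subset M S he⟩
    · rintro ⟨hey, heS⟩
      by_cases hc : e ∈ coloopsOf M S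
      · exact Or.inr ⟨hey, hc⟩
      · exact Or.inl (Finset.mem_sdiff.2 ⟨heS, hc⟩)
  rw [heq]
  exact (mem_coloopsOf.1 hy).2

/-- **The direct-sum formula for the denominator**: `D(S) = Σ_{j ≤ 3} C(#coloops(S), j)·Φ_{3−j}(K(S))`. -/
theorem D_eq_sum_cyclicPart {S : Finset α} (hS : S ⊆ gr M) :
    D M S = ∑ j ∈ Finset.range 4, (((coloopsOf M S).card.choose j : ℕ) : ℚ) * Phi M (3 - j) (cyclicPart M S) := by
  have hK : cyclicPart M S ⊆ gr M := (cyclicPart_subset M S).trans hS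
  have hY : coloopsOf M S ⊆ gr M := (coloopsOf_subset M S).trans hS
  conv_lhs => rw [← cyclicPart_union_coloopsOf (M := M) S]
  rw [D_eq_Phi_three (Finset.union_subset hK hY)]
  exact Phi_union_of_coloops hK (coloopsOf M S) hY (fun y hy => coloops_notMem_closure hy) 3

/-- The nullity of the cyclic part equals the nullity of `S`: `|K(S)| = ρ(K(S)) + (|S| − ρ(S))` in the form
`ρ(K(S)) + #coloops(S) = ρ(S)` with `|S| = |K(S)| + #coloops(S)`. -/
theorem card_cyclicPart_add (S : Finset α) : (cyclicPart M S).card + (coloopsOf M S).card = S.card := by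
  rw [← Finset.card_union_of_disjoint (disjoint_cyclicPart_coloopsOf S), cyclicPart_union_coloopsOf]

end SevenThree

end PercRepro
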